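import Literature.Analysis.FluidPDE.KwonHarmonicPart
import Literature.Analysis.FluidPDE.OffDiagonalHeatSmoothing
import HarnessLib

/-!
# Kwon's harmonic part: sup bounds for the derivatives of all orders ((est.h), every `k`)

Analysis/FluidPDE proof file (theorems only) on the discharge path of the named fact
`Literature.Analysis.FluidPDE.kwon2023_velocity_epsilon_regularity`
(`PressureFreeEpsilonRegularity.lean`; H. Kwon, J. Differential Equations (2023) =
arXiv:2104.03160, Thm. 1.4). Kwon's Lemma 2.5 states (est.h)
"`‖∇ᵏh‖_{L^r(a,b;L^∞(B₁))} ≲_k ‖u‖_{L^r(a,b;L¹(B₂))} for any `k ≥ 0`" (Remark 2.3 (2.3):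
`h = −curl(∇Φ × Δ⁻¹((1−φ)ω))` is harmonic in `Ω₁` with all interior derivative estimates). The
tree has the slice form for `k = 0, 1` (`KwonHarmonicPart`) and `k = 2` (`KwonHarmonicPartSecond`);
this file proves it for EVERY `k`, globally in `x`:

* `Kwon2023.exists_norm_iteratedFDeriv_harmonicPart_le m :
  ∃ C, ∀ u ∈ L¹(B₂), ∀ x, ‖Dᵐ h(x)‖ ≤ C ∫_{B₂} |u|` for `h = H u = harmonicPart u`.

Mechanism: `h = ∇(k ⋆ (u·∇φ)) − curl(k ⋆ (∇φ × u))` with the smooth compactly supported annular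
kernel `k`; all derivatives fall on the kernel (the tree's all-order convolution bound
`OffDiagHeat.norm_iteratedFDeriv_convolution_le`, after writing the potentials as convolutions of
the scalar densities `u·∇φ`, `(∇φ × u)ⱼ` with the vector kernels `k`, `k eⱼ`), and the densities
have `L¹` norm `≤ ‖∇φ‖_∞ ∫_{B₂}|u|`. This is the input "(est.h) for all `k`" of the local energy
step of Lemma 2.5 (smoothness in `x` of the time-mollified drift, design memo
`kits/A4-R1b-localEnergy-design-ser-a-g8.md` (O3)). No NS-regularity statement is touched.

## Mathlib / tree search

Tree (reused): `harmonicPart`, `annularKernel`, `contDiff_annularKernel`,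
`hasCompactSupport_annularKernel`, `scalarDensity`, `vectorDensity`, `integrable_scalarDensity`,
`integrable_vectorDensity`, `integral_norm_scalarDensity_le`, `integral_norm_vectorDensity_le`,
`exists_bound_gradient_kwonCutoff`, `contDiff_potential_scalar/vector`, `curl_eq_curlCLM_comp`
(`KwonHarmonicPart`, `VectorCalculus`); `OffDiagHeat.norm_iteratedFDeriv_convolution_le`,
`OffDiagHeat.contDiff_convolution_lsmul` (`OffDiagonalHeatSmoothing`). Mathlib:
`convolution_flip`, `convolution_lsmul`, `convolution_lsmul_swap`, `iteratedFDeriv_sub_apply`,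
`iteratedFDeriv_sum_apply`, `norm_iteratedFDeriv_fderiv`,
`LinearIsometryEquiv.norm_iteratedFDeriv_comp_left`, `ContinuousLinearMap.norm_iteratedFDeriv_comp_left`,
`HasCompactSupport.iteratedFDeriv`, `EuclideanSpace.basisFun`.

## References

* H. Kwon, *The role of the pressure in the regularity theory for the Navier–Stokes equations*,
  J. Differential Equations 357 (2023) = arXiv:2104.03160: Remark 2.3 (2.3)–(2.4) and Lemma 2.5
  (est.h) ("for any `k ≥ 0`"). [Kwon2023RolePressure]
-/

noncomputable section

open MeasureTheory Set Function Filter Topology TopologicalSpace Metric InnerProductSpace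
  ContinuousLinearMap
open scoped NNReal ENNReal RealInnerProductSpace Convolution ContDiff

namespace Literature.Analysis.FluidPDE

namespace Kwon2023

variable {u : EuclideanSpace ℝ (Fin 3) → EuclideanSpace ℝ (Fin 3)}

/-! ### The potentials as convolutions of scalar densities with vector kernels -/

/-- Real convolution is commutative: `k ⋆ s = s ⋆ k` for scalar `k`, `s`. [folklore] -/
private theorem convolution_comm_real (k s : EuclideanSpace ℝ (Fin 3) → ℝ) :
    k ⋆[lsmul ℝ ℝ, volume] s = s ⋆[lsmul ℝ ℝ, volume] k := by
  rw [← convolution_flip]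
  have hL : (lsmul ℝ ℝ : ℝ →L[ℝ] ℝ →L[ℝ] ℝ).flip = lsmul ℝ ℝ := by
    ext; simp
  rw [hL]

/-- The coordinate densities `(∇φ × u)ⱼ` are integrable. [folklore] -/
private theorem integrable_vectorDensity_coord (hu : IntegrableOn u (ball (0 : EuclideanSpace ℝ (Fin 3)) 2))
    (j : Fin 3) : Integrable fun s => vectorDensity u s j := by
  have hv := integrable_vectorDensity hu
  refine hv.norm.mono' ((EuclideanSpace.proj j).continuous.comp_aestronglyMeasurable hv.aestronglyMeasurable)
    (Eventually.of_forall fun s => ?_)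
  simpa using PiLp.norm_apply_le (p := 2) (vectorDensity u s) j

/-- `∫ |(∇φ × u)ⱼ| ≤ ∫ |∇φ × u|`. [folklore] -/
private theorem integral_norm_vectorDensity_coord_le (hu : IntegrableOn u (ball (0 : EuclideanSpace ℝ (Fin 3)) 2))
    (j : Fin 3) : ∫ s, ‖vectorDensity u s j‖ ≤ ∫ s, ‖vectorDensity u s‖ :=
  integral_mono_of_nonneg (Eventually.of_forall fun s => norm_nonneg _) (integrable_vectorDensity hu).norm
    (Eventually.of_forall fun s => by simpa using PiLp.norm_apply_le (p := 2) (vectorDensity u s) j)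

/-- **The vector potential, coordinatewise**: `k ⋆ (∇φ × u) = Σⱼ (∇φ × u)ⱼ ⋆ (k eⱼ)`. [folklore] -/
private theorem potential_vector_eq_sum (hu : IntegrableOn u (ball (0 : EuclideanSpace ℝ (Fin 3)) 2)) :
    (annularKernel ⋆[lsmul ℝ ℝ, volume] vectorDensity u) = fun x =>
      ∑ j : Fin 3, ((fun s => vectorDensity u s j) ⋆[lsmul ℝ ℝ, volume]
        (fun t => annularKernel t • (EuclideanSpace.basisFun (Fin 3) ℝ j : EuclideanSpace ℝ (Fin 3)))) x := by
  set e := EuclideanSpace.basisFun (Fin 3) ℝ with he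
  obtain ⟨K, hK⟩ := hasCompactSupport_annularKernel.exists_bound_of_continuous
    (contDiff_annularKernel (n := 0)).continuous
  funext x
  rw [convolution_lsmul_swap]
  have hexp : ∀ t, annularKernel (x - t) • vectorDensity u t =
      ∑ j : Fin 3, vectorDensity u t j • (annularKernel (x - t) • (e j : EuclideanSpace ℝ (Fin 3))) := by
    intro t
    conv_lhs => rw [← e.sum_repr (vectorDensity u t)]
    simp only [Finset.smul_sum, EuclideanSpace.basisFun_repr, he]
    refine Finset.sum_congr rfl fun j _ => ?_
    rw [smul_comm]
  simp_rw [hexp]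
  have hint : ∀ j : Fin 3, Integrable fun t =>
      vectorDensity u t j • (annularKernel (x - t) • (e j : EuclideanSpace ℝ (Fin 3))) := by
    intro j
    have hm : AEStronglyMeasurable (fun t => vectorDensity u t j •
        (annularKernel (x - t) • (e j : EuclideanSpace ℝ (Fin 3)))) volume :=
      (integrable_vectorDensity_coord hu j).aestronglyMeasurable.smul
        (((contDiff_annularKernel (n := 0)).continuous.comp (continuous_const.sub continuous_id)).smul
          continuous_const).aestronglyMeasurable
    refine ((integrable_vectorDensity_coord hu j).norm.mul_const (K * ‖(e j : EuclideanSpace ℝ (Fin 3))‖)).mono' hm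
      (Eventually.of_forall fun t => ?_)
    rw [norm_smul, norm_smul]
    exact mul_le_mul_of_nonneg_left (mul_le_mul_of_nonneg_right (hK _) (norm_nonneg _)) (norm_nonneg _)
  rw [integral_finsetSum _ fun j _ => hint j]
  refine Finset.sum_congr rfl fun j _ => ?_
  rw [convolution_lsmul]

/-! ### (est.h) at every order -/

/-- **The derivatives of all orders of the harmonic part are bounded by the `L¹(B₂)` norm of the
velocity** (Kwon 2023, Remark 2.3 (2.3)–(2.4) and Lemma 2.5, (est.h) "for any `k ≥ 0`", at a fixed
time; globally in `x`): for every `m` there is an absolute `C` with `‖Dᵐ h(x)‖ ≤ C ∫_{B₂} |u|`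
for every `u ∈ L¹(B₂)` and every `x`. [cite: Kwon2023RolePressure, Lemma 2.5 (est.h) with Remark 2.3] -/
theorem exists_norm_iteratedFDeriv_harmonicPart_le (m : ℕ) :
    ∃ C : ℝ, 0 ≤ C ∧ ∀ (u : EuclideanSpace ℝ (Fin 3) → EuclideanSpace ℝ (Fin 3)),
      IntegrableOn u (ball (0 : EuclideanSpace ℝ (Fin 3)) 2) →
      ∀ x, ‖iteratedFDeriv ℝ m (harmonicPart u) x‖ ≤
        C * ∫ y in ball (0 : EuclideanSpace ℝ (Fin 3)) 2, ‖u y‖ := by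
  set e := EuclideanSpace.basisFun (Fin 3) ℝ with he
  obtain ⟨Cφ, hCφ0, hCφ⟩ := exists_bound_gradient_kwonCutoff
  -- the kernels `k` and `k eⱼ` and bounds for their `(m+1)`-st derivatives
  have hk : ContDiff ℝ ∞ annularKernel := contDiff_annularKernel
  have hkc : HasCompactSupport annularKernel := hasCompactSupport_annularKernel
  obtain ⟨B₀, hB₀⟩ := (hkc.iteratedFDeriv (𝕜 := ℝ) (m + 1)).exists_bound_of_continuous
    (hk.continuous_iteratedFDeriv (by exact_mod_cast le_top))
  have hB₀0 : 0 ≤ B₀ := (norm_nonneg _).trans (hB₀ 0)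
  have hKj : ∀ j : Fin 3, ContDiff ℝ ∞ fun t => annularKernel t • (e j : EuclideanSpace ℝ (Fin 3)) :=
    fun j => hk.smul contDiff_const
  have hKjc : ∀ j : Fin 3, HasCompactSupport fun t => annularKernel t • (e j : EuclideanSpace ℝ (Fin 3)) :=
    fun j => hkc.smul_right
  have hBj : ∀ j : Fin 3, ∃ B : ℝ, 0 ≤ B ∧ ∀ p,
      ‖iteratedFDeriv ℝ (m + 1) (fun t => annularKernel t • (e j : EuclideanSpace ℝ (Fin 3))) p‖ ≤ B := by
    intro j
    obtain ⟨B, hB⟩ := ((hKjc j).iteratedFDeriv (𝕜 := ℝ) (m + 1)).exists_bound_of_continuous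
      ((hKj j).continuous_iteratedFDeriv (by exact_mod_cast le_top))
    exact ⟨max B 0, le_max_right _ _, fun p => (hB p).trans (le_max_left _ _)⟩
  choose B hB0 hB using hBj
  refine ⟨(B₀ + ‖curlCLM‖ * ∑ j, B j) * Cφ,
    mul_nonneg (add_nonneg hB₀0 (mul_nonneg (norm_nonneg curlCLM) (Finset.sum_nonneg fun j _ => hB0 j))) hCφ0,
    fun u hu x => ?_⟩
  set I : ℝ := ∫ y in ball (0 : EuclideanSpace ℝ (Fin 3)) 2, ‖u y‖ with hI
  have hI0 : 0 ≤ I := integral_nonneg fun y => norm_nonneg _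
  have hs := integrable_scalarDensity hu
  have hv := integrable_vectorDensity hu
  have hs1 : ∫ y, ‖scalarDensity u y‖ ≤ Cφ * I := integral_norm_scalarDensity_le hCφ hu
  have hv1 : ∫ y, ‖vectorDensity u y‖ ≤ Cφ * I := integral_norm_vectorDensity_le hCφ hu
  -- the scalar potential `F = k ⋆ s = s ⋆ k`
  set F : EuclideanSpace ℝ (Fin 3) → ℝ := annularKernel ⋆[lsmul ℝ ℝ, volume] scalarDensity u with hFdef
  have hF : ContDiff ℝ ∞ F := contDiff_potential_scalar hs.locallyIntegrable
  have hFm : ‖iteratedFDeriv ℝ (m + 1) F x‖ ≤ B₀ * (Cφ * I) := by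
    rw [hFdef, convolution_comm_real]
    exact (OffDiagHeat.norm_iteratedFDeriv_convolution_le (μ := volume) (m + 1) hk hkc hB₀ hs x).trans
      (mul_le_mul_of_nonneg_left hs1 hB₀0)
  -- the vector potential `V = k ⋆ v = Σⱼ vⱼ ⋆ (k eⱼ)`
  set V : EuclideanSpace ℝ (Fin 3) → EuclideanSpace ℝ (Fin 3) :=
    annularKernel ⋆[lsmul ℝ ℝ, volume] vectorDensity u with hVdef
  have hV : ContDiff ℝ ∞ V := contDiff_potential_vector hv.locallyIntegrable
  have hVj : ∀ j : Fin 3, ContDiff ℝ ∞ ((fun s => vectorDensity u s j) ⋆[lsmul ℝ ℝ, volume]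
      (fun t => annularKernel t • (e j : EuclideanSpace ℝ (Fin 3)))) := fun j =>
    OffDiagHeat.contDiff_convolution_lsmul (hKj j) (hKjc j) (integrable_vectorDensity_coord hu j).locallyIntegrable
  have hVm : ‖iteratedFDeriv ℝ (m + 1) V x‖ ≤ (∑ j, B j) * (Cφ * I) := by
    rw [hVdef, potential_vector_eq_sum hu]
    have esum : (fun y => ∑ j : Fin 3, ((fun s => vectorDensity u s j) ⋆[lsmul ℝ ℝ, volume]
        (fun t => annularKernel t • (e j : EuclideanSpace ℝ (Fin 3)))) y) =
        ∑ j : Fin 3, ((fun s => vectorDensity u s j) ⋆[lsmul ℝ ℝ, volume]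
          (fun t => annularKernel t • (e j : EuclideanSpace ℝ (Fin 3)))) := by
      funext y; simp only [Finset.sum_apply]
    rw [esum, iteratedFDeriv_sum_apply fun j _ => ((hVj j).of_le (by exact_mod_cast le_top)).contDiffAt,
      Finset.sum_mul]
    refine (norm_sum_le _ _).trans (Finset.sum_le_sum fun j _ => ?_)
    exact (OffDiagHeat.norm_iteratedFDeriv_convolution_le (μ := volume) (m + 1) (hKj j) (hKjc j) (hB j)
      (integrable_vectorDensity_coord hu j) x).trans
      (mul_le_mul_of_nonneg_left ((integral_norm_vectorDensity_coord_le hu j).trans hv1) (hB0 j))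
  -- `h = ∇F − curl V`
  set T := (InnerProductSpace.toDual ℝ (EuclideanSpace ℝ (Fin 3))).symm with hT
  have e1 : (fun w => gradient F w) = T ∘ fderiv ℝ F := by funext w; rfl
  have e2 : (fun w => curl V w) = curlCLM ∘ fderiv ℝ V := by funext w; rw [curl_eq_curlCLM_comp]
  have eh : harmonicPart u = (fun w => gradient F w) - fun w => curl V w := by
    funext w; rfl
  have hgradC : ContDiff ℝ ∞ fun w => gradient F w := by
    rw [e1]; exact T.contDiff.comp (hF.fderiv_right (by exact_mod_cast le_top))
  have hcurlC : ContDiff ℝ ∞ fun w => curl V w := by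
    rw [e2]; exact curlCLM.contDiff.comp (hV.fderiv_right (by exact_mod_cast le_top))
  have hdF : ContDiffAt ℝ m (fderiv ℝ F) x :=
    ((hF.fderiv_right (m := m) (by exact_mod_cast le_top)).of_le le_rfl).contDiffAt
  have hdV : ContDiffAt ℝ m (fderiv ℝ V) x :=
    ((hV.fderiv_right (m := m) (by exact_mod_cast le_top)).of_le le_rfl).contDiffAt
  have h1 : ‖iteratedFDeriv ℝ m (fun w => gradient F w) x‖ ≤ B₀ * (Cφ * I) := by
    rw [e1, LinearIsometryEquiv.norm_iteratedFDeriv_comp_left, norm_iteratedFDeriv_fderiv]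
    exact hFm
  have h2 : ‖iteratedFDeriv ℝ m (fun w => curl V w) x‖ ≤ ‖curlCLM‖ * ((∑ j, B j) * (Cφ * I)) := by
    rw [e2]
    refine (ContinuousLinearMap.norm_iteratedFDeriv_comp_left curlCLM hdV le_rfl).trans ?_
    rw [norm_iteratedFDeriv_fderiv]
    exact mul_le_mul_of_nonneg_left hVm (norm_nonneg _)
  rw [eh, iteratedFDeriv_sub_apply ((hgradC.of_le (by exact_mod_cast le_top)).contDiffAt)
    ((hcurlC.of_le (by exact_mod_cast le_top)).contDiffAt)]
  calc ‖iteratedFDeriv ℝ m (fun w => gradient F w) x - iteratedFDeriv ℝ m (fun w => curl V w) x‖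
      ≤ ‖iteratedFDeriv ℝ m (fun w => gradient F w) x‖ + ‖iteratedFDeriv ℝ m (fun w => curl V w) x‖ :=
        norm_sub_le _ _
    _ ≤ B₀ * (Cφ * I) + ‖curlCLM‖ * ((∑ j, B j) * (Cφ * I)) := add_le_add h1 h2
    _ = (B₀ + ‖curlCLM‖ * ∑ j, B j) * Cφ * I := by ring

end Kwon2023

end Literature.Analysis.FluidPDE

end
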